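import Mathlib

/-!
# The `δ`-regularised coefficient `r · conj G / (|G|² + δ)`

In the `δ`-regularised similarity principle the discontinuous coefficient `r / G` is replaced
by the smooth coefficient `a_δ := r · conj G / (|G|² + δ)`. This file packages its four
properties: smoothness, compact support (inherited from `r`), the uniform bound `‖a_δ‖ ≤ M`
(from `|r| ≤ M |G|`), and the approximation `‖r - a_δ G‖ ≤ M √δ / 2`, which follows from the
identity `r - a_δ G = r δ / (|G|² + δ)` and AM–GM `2 |G| √δ ≤ |G|² + δ`.
-/

set_option linter.dupNamespace false

noncomputable section

open scoped ContDiff ComplexConjugate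

namespace Summit.SmoothPoincare4.SmoothPoincare4.Cruxes.TameOrBrodyR4.Sketch

namespace RegularisedCoefficient

/-- The regularising denominator `‖z‖² + δ` is positive. -/
theorem denom_pos (z : ℂ) {δ : ℝ} (hδ : 0 < δ) : 0 < ‖z‖ ^ 2 + δ := by positivity

/-- The regularising denominator, cast to `ℂ`, is nonzero. -/
theorem denom_ne_zero (z : ℂ) {δ : ℝ} (hδ : 0 < δ) : (((‖z‖ ^ 2 + δ : ℝ)) : ℂ) ≠ 0 :=
  Complex.ofReal_ne_zero.2 (denom_pos z hδ).ne'

/-- Smoothness of `η ↦ ((‖G η‖² + δ : ℝ) : ℂ)`. -/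
theorem contDiff_denom (G : ℂ → ℂ) (δ : ℝ) (hG : ContDiff ℝ ∞ G) :
    ContDiff ℝ ∞ (fun η => (((‖G η‖ ^ 2 + δ : ℝ)) : ℂ)) := by
  have h1 : ContDiff ℝ ∞ (fun η => ‖G η‖ ^ 2 + δ) :=
    ((contDiff_norm_sq ℝ).comp hG).add contDiff_const
  exact Complex.ofRealCLM.contDiff.comp h1

/-- Smoothness of the regularised coefficient. -/
theorem contDiff_coeff (G r : ℂ → ℂ) (δ : ℝ) (hδ : 0 < δ)
    (hG : ContDiff ℝ ∞ G) (hr : ContDiff ℝ ∞ r) :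
    ContDiff ℝ ∞ (fun η => r η * conj (G η) / (((‖G η‖ ^ 2 + δ : ℝ)) : ℂ)) := by
  have hconj : ContDiff ℝ ∞ (fun η => conj (G η)) := Complex.conjCLE.contDiff.comp hG
  have hinv : ContDiff ℝ ∞ (fun η => ((((‖G η‖ ^ 2 + δ : ℝ)) : ℂ))⁻¹) :=
    (contDiff_denom G δ hG).inv fun η => denom_ne_zero (G η) hδ
  simpa only [div_eq_mul_inv] using (hr.mul hconj).mul hinv

/-- The regularised coefficient vanishes wherever `r` does, hence has compact support. -/
theorem hasCompactSupport_coeff (G r : ℂ → ℂ) (ρ₀ δ : ℝ)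
    (hsupp : ∀ η : ℂ, ρ₀ ≤ ‖η‖ → r η = 0) :
    HasCompactSupport (fun η => r η * conj (G η) / (((‖G η‖ ^ 2 + δ : ℝ)) : ℂ)) := by
  refine HasCompactSupport.intro (isCompact_closedBall (0 : ℂ) ρ₀) fun η hη => ?_
  have hρ : ρ₀ ≤ ‖η‖ := by
    rw [Metric.mem_closedBall, dist_zero_right, not_le] at hη
    exact hη.le
  simp [hsupp η hρ]

/-- Norm of the regularised coefficient. -/
theorem norm_coeff (G r : ℂ → ℂ) (δ : ℝ) (hδ : 0 < δ) (η : ℂ) :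
    ‖r η * conj (G η) / (((‖G η‖ ^ 2 + δ : ℝ)) : ℂ)‖ =
      ‖r η‖ * ‖G η‖ / (‖G η‖ ^ 2 + δ) := by
  rw [norm_div, norm_mul, Complex.norm_conj, Complex.norm_of_nonneg (denom_pos (G η) hδ).le]

/-- The uniform bound `‖a_δ‖ ≤ M`. -/
theorem norm_coeff_le (G r : ℂ → ℂ) (M δ : ℝ) (hM : 0 ≤ M) (hδ : 0 < δ)
    (hbound : ∀ η, ‖r η‖ ≤ M * ‖G η‖) (η : ℂ) :
    ‖r η * conj (G η) / (((‖G η‖ ^ 2 + δ : ℝ)) : ℂ)‖ ≤ M := by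
  rw [norm_coeff G r δ hδ η, div_le_iff₀ (denom_pos (G η) hδ)]
  calc ‖r η‖ * ‖G η‖ ≤ M * ‖G η‖ * ‖G η‖ :=
        mul_le_mul_of_nonneg_right (hbound η) (norm_nonneg _)
    _ ≤ M * (‖G η‖ ^ 2 + δ) := by nlinarith [mul_nonneg hM hδ.le]

/-- The key algebraic identity `r - a_δ G = r δ / (|G|² + δ)`. -/
theorem sub_coeff_mul (G r : ℂ → ℂ) (δ : ℝ) (hδ : 0 < δ) (η : ℂ) :
    r η - r η * conj (G η) / (((‖G η‖ ^ 2 + δ : ℝ)) : ℂ) * G η =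
      r η * (δ : ℂ) / (((‖G η‖ ^ 2 + δ : ℝ)) : ℂ) := by
  set N : ℂ := (((‖G η‖ ^ 2 + δ : ℝ)) : ℂ) with hN
  have hne : N ≠ 0 := denom_ne_zero (G η) hδ
  have hkey : conj (G η) * G η = N - δ := by
    rw [Complex.conj_mul', hN]
    push_cast
    ring
  have hu : N * N⁻¹ = 1 := mul_inv_cancel₀ hne
  simp only [div_eq_mul_inv]
  linear_combination (-r η) * hu - (r η * N⁻¹) * hkey

/-- AM–GM in the form `|G| δ ≤ (√δ / 2) (|G|² + δ)`. -/
theorem mul_le_sqrt_half_mul (g δ : ℝ) (hg : 0 ≤ g) (hδ : 0 < δ) :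
    g * δ ≤ Real.sqrt δ / 2 * (g ^ 2 + δ) := by
  have hs : Real.sqrt δ ^ 2 = δ := Real.sq_sqrt hδ.le
  have h0 : 0 ≤ Real.sqrt δ * (g - Real.sqrt δ) ^ 2 :=
    mul_nonneg (Real.sqrt_nonneg δ) (sq_nonneg _)
  nlinarith [h0, hs, hg, Real.sqrt_nonneg δ]

/-- The approximation bound `‖r - a_δ G‖ ≤ M √δ / 2`. -/
theorem norm_sub_le (G r : ℂ → ℂ) (M δ : ℝ) (hM : 0 ≤ M) (hδ : 0 < δ)
    (hbound : ∀ η, ‖r η‖ ≤ M * ‖G η‖) (η : ℂ) :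
    ‖r η - r η * conj (G η) / (((‖G η‖ ^ 2 + δ : ℝ)) : ℂ) * G η‖ ≤ M * Real.sqrt δ / 2 := by
  have hNpos := denom_pos (G η) hδ
  rw [sub_coeff_mul G r δ hδ η, norm_div, norm_mul, Complex.norm_of_nonneg hδ.le,
    Complex.norm_of_nonneg hNpos.le, div_le_iff₀ hNpos]
  calc ‖r η‖ * δ ≤ M * ‖G η‖ * δ := mul_le_mul_of_nonneg_right (hbound η) hδ.le
    _ = M * (‖G η‖ * δ) := by ring
    _ ≤ M * (Real.sqrt δ / 2 * (‖G η‖ ^ 2 + δ)) :=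
        mul_le_mul_of_nonneg_left (mul_le_sqrt_half_mul ‖G η‖ δ (norm_nonneg _) hδ) hM
    _ = M * Real.sqrt δ / 2 * (‖G η‖ ^ 2 + δ) := by ring

end RegularisedCoefficient

/-- The `δ`-regularised coefficient `a_δ := r · conj G / (|G|² + δ)` of the similarity
principle: for smooth `G`, `r` with `|r| ≤ M |G|` and `r = 0` for `‖η‖ ≥ ρ₀`, the coefficient
`a_δ` is smooth, compactly supported, bounded by `M` uniformly in `δ`, and `a_δ G` approximates
`r` up to `M √δ / 2`. -/
theorem helper_regularisedCoefficient (G r : ℂ → ℂ) (M ρ₀ δ : ℝ) (hM : 0 ≤ M) (hδ : 0 < δ)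
    (hG : ContDiff ℝ ∞ G) (hr : ContDiff ℝ ∞ r)
    (hbound : ∀ η, ‖r η‖ ≤ M * ‖G η‖) (hsupp : ∀ η : ℂ, ρ₀ ≤ ‖η‖ → r η = 0) :
    ContDiff ℝ ∞ (fun η => r η * (starRingEnd ℂ) (G η) / (((‖G η‖ ^ 2 + δ : ℝ)) : ℂ)) ∧
    HasCompactSupport (fun η => r η * (starRingEnd ℂ) (G η) / (((‖G η‖ ^ 2 + δ : ℝ)) : ℂ)) ∧
    (∀ η, ‖r η * (starRingEnd ℂ) (G η) / (((‖G η‖ ^ 2 + δ : ℝ)) : ℂ)‖ ≤ M) ∧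
    (∀ η, ‖r η - r η * (starRingEnd ℂ) (G η) / (((‖G η‖ ^ 2 + δ : ℝ)) : ℂ) * G η‖ ≤
      M * Real.sqrt δ / 2) :=
  ⟨RegularisedCoefficient.contDiff_coeff G r δ hδ hG hr,
    RegularisedCoefficient.hasCompactSupport_coeff G r ρ₀ δ hsupp,
    fun η => RegularisedCoefficient.norm_coeff_le G r M δ hM hδ hbound η,
    fun η => RegularisedCoefficient.norm_sub_le G r M δ hM hδ hbound η⟩

end Summit.SmoothPoincare4.SmoothPoincare4.Cruxes.TameOrBrodyR4.Sketch
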